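import Summits.BirchSwinnertonDyer.BirchSwinnertonDyer.Theorems.ThetaPartnerAtTwoSignedMainConjectureCMTwoRankZeroFlatTwistImaginarySibling
import Summits.BirchSwinnertonDyer.BirchSwinnertonDyer.Theorems.ThetaPartnerAtTwoSignedMainConjectureCMTwoRankZeroFlatTwistMinusUnit
import HarnessLib

/-!
# Route `ThetaPartnerAtTwo`, crux K2r0P `SignedMainConjectureCMTwoRankZeroOfPub` (stmt-BirchSwinnertonDyer-24945),
# line `rankzero` v14, stub (μ♭)_A: imaginary prime twists of FLAT FROM PRINT — the displayed minus-period unit H⁻(W)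
# discharged by Abbes–Ullmo (named fact), so the sibling transport holds modulo `hmod` + `hAU` (+ `hBF hLrat hGZK` for anchors)

Cell `bsd-wall`, width seat `bsd-wall-tp2-p2-w3` (g2). THEOREMS ONLY (no `def`, no named fact, no `sorry`); helper `--supports`
the crux; sequel of `…FlatTwistImaginarySibling` and `…FlatTwistMinusUnit`. BSD is not proved by any of this.

`…FlatTwistMinusUnit.imaginaryPeriodRat_eq_unit_mul_minusPeriod_two_of_abbesUllmo` supplies H⁻(W) for every curve of the
K2r0P habitat (`GoodSS W 2` ⇒ good at `2` and `E[2]` irreducible; `Δ(W) < 0`) from the named fact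
`abbesUllmo_not_dvd_maninConstant_of_not_dvd_level` (Abbes–Ullmo 1996 Thm. A) — the SAME print input that yields the PUB fact
`realPeriodRat_eq_unit_mul_plusPeriod_two` (`realPeriodRat_eq_unit_mul_plusPeriod_two_fact_of_abbesUllmo`). Hence:

* `exists_minusUnit_of_abbesUllmo` — H⁻(W) in the binder shape of `…FlatTwistImaginary*`;
* **`analyticMuFlat_negTwist_at_of_sibling_of_abbesUllmo`** — (μ♭) at every rank-`0` imaginary prime twist `A = W^{(d)}` of a
  base `W` (globally minimal, good supersingular at `2`, `a₂(W) = 0`, `Δ(W) < 0`) from the plus certificate of another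
  imaginary prime twist `A₁ = W^{(d₁)}`, granted `hmod` and `hAU` only;
* `analyticMuFlat_negTwist_at_of_flatAtTwo_anchor_of_abbesUllmo` (FLAT at a rank-`0` sibling `A₁` ⇒ (μ♭) at `A`),
  `analyticMuFlat_negTwist_at_of_unitZone_anchor_of_abbesUllmo`, `analyticMuFlat_negTwist_at_of_levelSixteen_anchor_of_abbesUllmo`
  (PUB facts `hBF hLrat hGZK` + `hmod` + `hAU` by name; e.g. `W = 121b`, `A₁ = 5929a`, `A = 121b^{(−q)}`).

References: A. Abbes, E. Ullmo, Compositio Math. 103 (1996) Thm. A [AbbesUllmo1996]; R. Greenberg, V. Vatsal, Invent. Math.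
142 (2000) §3 Rem. 3.4 [GreenbergVatsal2000]; B. Mazur, J. Tate, J. Teitelbaum, Invent. Math. 84 (1986) §I.8
[MazurTateTeitelbaum1986Invent]; V. Pal, Proc. AMS 140 (2012) Thm. 3.2 [Pal2012]; R. Pollack, Duke Math. J. 118 (2003)
Prop. 6.18 [Pollack2003]; A. Burungale, M. Flach (2024) Thm. 1.1 [BurungaleFlach2024].
-/

set_option autoImplicit false
-- the Theorems namespace of this sub repeats the summit name by design (D-0017 nested layout)
set_option linter.dupNamespace false

noncomputable section

open scoped Classical MatrixGroups ModularForm NumberField NumberTheorySymbols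

open NumberField IsDedekindDomain Rat.HeightOneSpectrum CongruenceSubgroup
  Literature.NumberTheory.EllipticCurves Literature.NumberTheory.GaloisRepresentations
  WeierstrassCurve Literature.NumberTheory.EllipticCurves.ModularForms Literature.NumberTheory.EllipticCurves.Rank1Residual
  Literature.NumberTheory.EllipticCurves.Rank1Residual.Typed
  Summit.BirchSwinnertonDyer.Rank1Residual Summit.BirchSwinnertonDyer.Rank1Residual.Supersingular

namespace Summit.BirchSwinnertonDyer.BirchSwinnertonDyer.Theorems.FlatTwist.Imaginary

section Print

variable (W : WeierstrassCurve ℚ) [W.IsElliptic] [W.IsGloballyMinimal] {d : ℤ} {A : WeierstrassCurve ℚ}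
  [A.IsElliptic] [A.IsGloballyMinimal] [NeZero (W.conductorNorm ℤ)] [NeZero (A.conductorNorm ℤ)]
  {fW : CuspForm (Gamma0 (W.conductorNorm ℤ)) 2} {fA : CuspForm (Gamma0 (A.conductorNorm ℤ)) 2}

omit [NeZero (W.conductorNorm ℤ)] in
/-- **H⁻(W) from Abbes–Ullmo** in the binder shape of the imaginary-twist files: for `W` globally minimal, good supersingular at
`2` (so `E[2]` is irreducible) with `Δ(W) < 0` and newform `f_W`: `|Ω⁻(W)| = ϖ · Ω⁻_{f_W}` with `‖ϖ‖₂ = 1`.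
[cite: AbbesUllmo1996, Thm. A] [cite: GreenbergVatsal2000, §3, Remark 3.4] -/
theorem exists_minusUnit_of_abbesUllmo (hAU : abbesUllmo_not_dvd_maninConstant_of_not_dvd_level)
    (hss : GoodSS W 2) (hΔ : W.Δ < 0) {N : ℕ} [NeZero N] (f : CuspForm (Gamma0 N) 2) (hf : IsNewformOf W f) :
    ∃ ϖ : ℚ, ‖(ϖ : ℚ_[2])‖ = 1 ∧ W.imaginaryPeriodRat = (ϖ : ℝ) * minusPeriod f :=
  imaginaryPeriodRat_eq_unit_mul_minusPeriod_two_of_abbesUllmo hAU W hss.1 (P2.irr_two_of_goodSS_two W hss) hΔ f hf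

/-- **(μ♭) AT AN IMAGINARY PRIME TWIST FROM A SIBLING, FROM PRINT.** Base `W` globally minimal, good supersingular at `2` with
`a₂(W) = 0`, `Δ(W) < 0`, newform `f_W`; two imaginary prime twists `A₁ = W^{(d₁)}` (carrying the plus certificate) and
`A = W^{(d)}` (`L(A,1) ≠ 0`), `d₁, d < 0`, `|d₁|, |d|` prime, `≡ 1 (mod 4)`, coprime to `N_W`, globally minimal models. Granted
`hmod` and Abbes–Ullmo `hAU` (which also yields the PUB period unit `h2`): (μ♭) at every Pollack pair of `f_A`.
[cite: AbbesUllmo1996, Thm. A] [cite: MazurTateTeitelbaum1986Invent, §I.8] [cite: Pal2012, Thm. 3.2 (case d < 0)] [cite: Pollack2003, Prop. 6.18] -/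
theorem analyticMuFlat_negTwist_at_of_sibling_of_abbesUllmo (hmod : exists_isNewformOf)
    (hAU : abbesUllmo_not_dvd_maninConstant_of_not_dvd_level)
    (hss : GoodSS W 2) (haW : W.frobeniusTrace 2 = 0) (hΔ : W.Δ < 0) (hfW : IsNewformOf W fW)
    {d₁ : ℤ} (hd₁ : d₁ < 0) (hd₁4 : d₁ % 4 = 1) (hp₁ : d₁.natAbs.Prime) (hcop₁ : IsCoprime d₁ (W.conductorNorm ℤ : ℤ))
    {A₁ : WeierstrassCurve ℚ} [A₁.IsElliptic] [A₁.IsGloballyMinimal] [NeZero (A₁.conductorNorm ℤ)] {C₁ : VariableChange ℚ}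
    (hA₁ : C₁ • W.quadraticTwist (d₁ : ℚ) = A₁) {f₁ : CuspForm (Gamma0 (A₁.conductorNorm ℤ)) 2} (hf₁ : IsNewformOf A₁ f₁)
    (hres : ∃ k : ℕ, 1 ≤ k ∧ ∃ b : ℤ, Odd b ∧ ∃ m : ℤ, Odd m ∧
      ratPlusSymbol f₁ ((b : ℚ) / 4 ^ k) = ratPlusSymbol f₁ 0 + (m : ℚ) / 2)
    (hd : d < 0) (hd4 : d % 4 = 1) (hp : d.natAbs.Prime) (hcop : IsCoprime d (W.conductorNorm ℤ : ℤ))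
    {C : VariableChange ℚ} (hA : C • W.quadraticTwist (d : ℚ) = A) (hfA : IsNewformOf A fA)
    (hLA : A.entireLFunction 1 ≠ 0) (Lplus Lminus : IwasawaAlgebra 2) (hPP : IsPollackPair fA 2 Lplus Lminus) :
    ∃ n : ℕ, IsUnit (PowerSeries.coeff n (kobayashiL 1 Lplus Lminus)) := by
  obtain ⟨ϖ, hϖ1, hϖ⟩ := exists_minusUnit_of_abbesUllmo W hAU hss hΔ fW hfW
  exact analyticMuFlat_negTwist_at_of_sibling W hmod (SkinnerUrban2014.realPeriodRat_eq_unit_mul_plusPeriod_two_fact_of_abbesUllmo hAU)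
    hss haW hΔ hfW hϖ1 hϖ hd₁ hd₁4 hp₁ hcop₁ hA₁ hf₁ hres hd hd4 hp hcop hA hfA hLA Lplus Lminus hPP

/-- **FLAT IS CLOSED UNDER PASSING BETWEEN IMAGINARY PRIME TWISTS, FROM PRINT**: as above with the plus certificate of `A₁`
replaced by FLAT at the rank-`0` sibling `(A₁, f₁)`. [cite: AbbesUllmo1996, Thm. A] [cite: Pollack2003, Prop. 6.18] -/
theorem analyticMuFlat_negTwist_at_of_flatAtTwo_anchor_of_abbesUllmo (hmod : exists_isNewformOf)
    (hAU : abbesUllmo_not_dvd_maninConstant_of_not_dvd_level)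
    (hss : GoodSS W 2) (haW : W.frobeniusTrace 2 = 0) (hΔ : W.Δ < 0) (hfW : IsNewformOf W fW)
    {d₁ : ℤ} (hd₁ : d₁ < 0) (hd₁4 : d₁ % 4 = 1) (hp₁ : d₁.natAbs.Prime) (hcop₁ : IsCoprime d₁ (W.conductorNorm ℤ : ℤ))
    {A₁ : WeierstrassCurve ℚ} [A₁.IsElliptic] [A₁.IsGloballyMinimal] [NeZero (A₁.conductorNorm ℤ)] {C₁ : VariableChange ℚ}
    (hA₁ : C₁ • W.quadraticTwist (d₁ : ℚ) = A₁) {f₁ : CuspForm (Gamma0 (A₁.conductorNorm ℤ)) 2} (hf₁ : IsNewformOf A₁ f₁)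
    (hr₁ : A₁.analyticRank = 0)
    (hflat₁ : ∀ Lplus Lminus : IwasawaAlgebra 2, IsPollackPair f₁ 2 Lplus Lminus → ¬ PowerSeries.C (2 : ℤ_[2]) ∣ Lminus)
    (hd : d < 0) (hd4 : d % 4 = 1) (hp : d.natAbs.Prime) (hcop : IsCoprime d (W.conductorNorm ℤ : ℤ))
    {C : VariableChange ℚ} (hA : C • W.quadraticTwist (d : ℚ) = A) (hfA : IsNewformOf A fA)
    (hLA : A.entireLFunction 1 ≠ 0) (Lplus Lminus : IwasawaAlgebra 2) (hPP : IsPollackPair fA 2 Lplus Lminus) :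
    ∃ n : ℕ, IsUnit (PowerSeries.coeff n (kobayashiL 1 Lplus Lminus)) := by
  obtain ⟨ϖ, hϖ1, hϖ⟩ := exists_minusUnit_of_abbesUllmo W hAU hss hΔ fW hfW
  exact analyticMuFlat_negTwist_at_of_flatAtTwo_anchor W hmod (SkinnerUrban2014.realPeriodRat_eq_unit_mul_plusPeriod_two_fact_of_abbesUllmo hAU)
    hss haW hΔ hfW hϖ1 hϖ hd₁ hd₁4 hp₁ hcop₁ hA₁ hf₁ hr₁ hflat₁ hd hd4 hp hcop hA hfA hLA Lplus Lminus hPP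

/-- **(μ♭) FROM A UNIT-ZONE IMAGINARY SIBLING, FROM PRINT** (`A₁` CM of analytic rank `0`, `2 ∤ #Ш(A₁)·∏c_ℓ(A₁)`; PUB facts
`hBF hLrat hGZK`, `hmod`, and Abbes–Ullmo `hAU`). [cite: BurungaleFlach2024, Thm. 1.1] [cite: AbbesUllmo1996, Thm. A] [cite: Pollack2003, Prop. 6.18] -/
theorem analyticMuFlat_negTwist_at_of_unitZone_anchor_of_abbesUllmo
    (hBF : bsdTriple_of_hasCM_of_L_one_ne_zero) (hmod : exists_isNewformOf) (hLrat : hasEntireLFunction_rat)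
    (hGZK : rank_eq_analyticRank_of_analyticRank_le_one) (hAU : abbesUllmo_not_dvd_maninConstant_of_not_dvd_level)
    (hss : GoodSS W 2) (haW : W.frobeniusTrace 2 = 0) (hΔ : W.Δ < 0) (hfW : IsNewformOf W fW)
    {d₁ : ℤ} (hd₁ : d₁ < 0) (hd₁4 : d₁ % 4 = 1) (hp₁ : d₁.natAbs.Prime) (hcop₁ : IsCoprime d₁ (W.conductorNorm ℤ : ℤ))
    {A₁ : WeierstrassCurve ℚ} [A₁.IsElliptic] [A₁.IsGloballyMinimal] [NeZero (A₁.conductorNorm ℤ)] {C₁ : VariableChange ℚ}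
    (hA₁ : C₁ • W.quadraticTwist (d₁ : ℚ) = A₁) {f₁ : CuspForm (Gamma0 (A₁.conductorNorm ℤ)) 2} (hf₁ : IsNewformOf A₁ f₁)
    (hcm₁ : A₁.HasCM) (hr₁ : A₁.analyticRank = 0) (hunit₁ : ¬ 2 ∣ A₁.shaOrder * A₁.tamagawaProduct)
    (hd : d < 0) (hd4 : d % 4 = 1) (hp : d.natAbs.Prime) (hcop : IsCoprime d (W.conductorNorm ℤ : ℤ))
    {C : VariableChange ℚ} (hA : C • W.quadraticTwist (d : ℚ) = A) (hfA : IsNewformOf A fA) (hrA : A.analyticRank = 0)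
    (Lplus Lminus : IwasawaAlgebra 2) (hPP : IsPollackPair fA 2 Lplus Lminus) :
    ∃ n : ℕ, IsUnit (PowerSeries.coeff n (kobayashiL 1 Lplus Lminus)) := by
  obtain ⟨ϖ, hϖ1, hϖ⟩ := exists_minusUnit_of_abbesUllmo W hAU hss hΔ fW hfW
  exact analyticMuFlat_negTwist_at_of_unitZone_anchor W hBF hmod hLrat hGZK
    (SkinnerUrban2014.realPeriodRat_eq_unit_mul_plusPeriod_two_fact_of_abbesUllmo hAU) hss haW hΔ hfW hϖ1 hϖ hd₁ hd₁4 hp₁ hcop₁ hA₁ hf₁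
    hcm₁ hr₁ hunit₁ hd hd4 hp hcop hA hfA hrA Lplus Lminus hPP

/-- **(μ♭) FROM A LEVEL-16-CERTIFIED IMAGINARY SIBLING, FROM PRINT** (`A₁` CM of analytic rank `0`, `N_{A₁} ≡ ±1 (mod 8)`,
`ord₂ #Ш(A₁) + ord₂ ∏c_ℓ(A₁) = 1`; PUB facts `hBF hLrat hGZK`, `hmod`, Abbes–Ullmo `hAU`). E.g. `W = 121b` (`Δ < 0`, `a₂ = 0`),
`A₁ = 5929a = W^{(−7)}`, `A = W^{(−q)}` for primes `q ≡ 3 (mod 4)`, `q ≠ 11`, of analytic rank `0`.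
[cite: BurungaleFlach2024, Thm. 1.1] [cite: MazurTateTeitelbaum1986Invent, §II.13] [cite: AbbesUllmo1996, Thm. A] [cite: Pollack2003, Prop. 6.18] -/
theorem analyticMuFlat_negTwist_at_of_levelSixteen_anchor_of_abbesUllmo
    (hBF : bsdTriple_of_hasCM_of_L_one_ne_zero) (hmod : exists_isNewformOf) (hLrat : hasEntireLFunction_rat)
    (hGZK : rank_eq_analyticRank_of_analyticRank_le_one) (hAU : abbesUllmo_not_dvd_maninConstant_of_not_dvd_level)
    (hss : GoodSS W 2) (haW : W.frobeniusTrace 2 = 0) (hΔ : W.Δ < 0) (hfW : IsNewformOf W fW)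
    {d₁ : ℤ} (hd₁ : d₁ < 0) (hd₁4 : d₁ % 4 = 1) (hp₁ : d₁.natAbs.Prime) (hcop₁ : IsCoprime d₁ (W.conductorNorm ℤ : ℤ))
    {A₁ : WeierstrassCurve ℚ} [A₁.IsElliptic] [A₁.IsGloballyMinimal] [NeZero (A₁.conductorNorm ℤ)] {C₁ : VariableChange ℚ}
    (hA₁ : C₁ • W.quadraticTwist (d₁ : ℚ) = A₁) {f₁ : CuspForm (Gamma0 (A₁.conductorNorm ℤ)) 2} (hf₁ : IsNewformOf A₁ f₁)
    (hcm₁ : A₁.HasCM) (hr₁ : A₁.analyticRank = 0)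
    (hN₁ : A₁.conductorNorm ℤ % 8 = 1 ∨ A₁.conductorNorm ℤ % 8 = 7)
    (hz₁ : padicValNat 2 A₁.shaOrder + padicValNat 2 A₁.tamagawaProduct = 1)
    (hd : d < 0) (hd4 : d % 4 = 1) (hp : d.natAbs.Prime) (hcop : IsCoprime d (W.conductorNorm ℤ : ℤ))
    {C : VariableChange ℚ} (hA : C • W.quadraticTwist (d : ℚ) = A) (hfA : IsNewformOf A fA) (hrA : A.analyticRank = 0)
    (Lplus Lminus : IwasawaAlgebra 2) (hPP : IsPollackPair fA 2 Lplus Lminus) :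
    ∃ n : ℕ, IsUnit (PowerSeries.coeff n (kobayashiL 1 Lplus Lminus)) := by
  obtain ⟨ϖ, hϖ1, hϖ⟩ := exists_minusUnit_of_abbesUllmo W hAU hss hΔ fW hfW
  exact analyticMuFlat_negTwist_at_of_levelSixteen_anchor W hBF hmod hLrat hGZK
    (SkinnerUrban2014.realPeriodRat_eq_unit_mul_plusPeriod_two_fact_of_abbesUllmo hAU) hss haW hΔ hfW hϖ1 hϖ hd₁ hd₁4 hp₁ hcop₁ hA₁ hf₁
    hcm₁ hr₁ hN₁ hz₁ hd hd4 hp hcop hA hfA hrA Lplus Lminus hPP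

end Print

end Summit.BirchSwinnertonDyer.BirchSwinnertonDyer.Theorems.FlatTwist.Imaginary

end
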